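import Literature.MathematicalPhysics.KineticTheory.LorentzGasMeasurability
import Literature.MathematicalPhysics.KineticTheory.LorentzGasEntranceChain
import Literature.Analysis.FunctionSpaces.PoissonMecke
import HarnessLib

/-!
# The `n`-scatterer term of the annealed Lorentz gas as a path integral
(trunk T-KINETIC; topic MathematicalPhysics/KineticTheory; proofs towards the core fact
`Literature.MathematicalPhysics.KineticTheory.gallavotti_lorentz_tendsto_dual` of `LorentzGasGallavotti`)

The probabilistic computation at the heart of Gallavotti's proof (Gallavotti 1972; Golse 2012,
proof of Thm. 2.1: `F_in` summed over the obstacles met, with the Poisson void probability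
`e^{-n|T|}` of the tube, and the change of variables to collision times and impact parameters;
Spohn 1991, proof of Thm. 8.8 (iii): "`P^ε(Δ)` is the probability to have exactly `n` scatterers
… and the others outside a tube … its density is (8.133)"): for Poisson scatterers of intensity
`λ = σ ε^{1-d}`, the expected sum over ordered `n`-tuples of distinct scatterers of the
`n`-scatterer functional `H` (`Kinetic.scattererFunctional`) equals `σⁿ` times the *iterated path
integral* of the deterministic chain functional damped by the void probability of the tube,
`Kinetic.lintegral_tsum_scattererFunctional_eq_pathLIntegral`:

`∫ ∑_{x ∈ cⁿ inj} H(x, c) P(dc) = σⁿ · pathLIntegral z n (Q ∘ virtualCentres ε z)`,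

where `Q = Kinetic.chainFunctional ω₀ ε z t φ P` is **Gallavotti's chain functional**
`Q(l) = 1{det ∧ self-avoiding}(l) · φ(end of the virtual orbit) · P{N(tube) = 0}` (a definition,
with its evaluation lemmas and measurability `Kinetic.measurable_chainFunctional_ofFn`,
`Kinetic.measurable_chainFunctional_virtualCentres`).

Steps: the multivariate Mecke equation (`Literature.Analysis.FunctionSpaces.IsPoissonPointProcess.multivariateMecke`, named fact, hypothesis) turns
the left side into `∫_{(λ Leb)ⁿ} 𝔼 H(x, c ∪ x) dx`; realizability for `c ∪ x` splits into the
deterministic conditions on `x`, self-avoidance of `x`, and voidness of the tube for `c`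
(`Kinetic.isRealizable_union_ofFn_iff`), whose probability factors out; `(λ Leb)ⁿ = λⁿ Lebⁿ`
(`Kinetic.pi_smul_volume`); the product integral is the iterated one
(`Kinetic.lintegral_pi_ofFn`); and the `n`-fold entrance parametrisation
(`Kinetic.iterLIntegral_hitChain_eq_pathLIntegral`, from the named fact P4, hypothesis) trades
`ε^{n(d-1)}` for the path coordinates, `λⁿ ε^{n(d-1)} = σⁿ`.

## References

* F. Golse, *Recent results on the periodic Lorentz gas*, Springer Basel (2011), §2, proof of
  Thm. 2.1 (arXiv:0906.0191).
* H. Spohn, *Large Scale Dynamics of Interacting Particles*, Springer (1991), proof of Thm. 8.8.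
* G. Last, M. Penrose, *Lectures on the Poisson Process*, CUP (2017), Thm. 4.4.
-/

open MeasureTheory Metric Real Set Filter Topology
open scoped InnerProductSpace ENNReal

namespace Literature.MathematicalPhysics.KineticTheory

noncomputable section

universe u

variable {d : Type u} [Fintype d]

/-- **Realizability for the augmented configuration splits**: `l = List.ofFn x` is realizable for
`c ∪ {x i}` iff it satisfies the deterministic chain conditions, is self-avoiding (its own centres
lie outside its tube), and no point of `c` lies in its tube. [folklore] -/
theorem isRealizable_union_ofFn_iff {E : Type*} [NormedAddCommGroup E] [InnerProductSpace ℝ E]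
    (ω₀ : sphere (0 : E) 1) (ε : ℝ) (z : E × E) (t : ℝ) {n : ℕ} (x : Fin n → E) (c : Literature.Analysis.FunctionSpaces.PointConfig E) :
    IsRealizable ω₀ ε z t (List.ofFn x) (c ∪ Literature.Analysis.FunctionSpaces.PointConfig.ofFn x) ↔
      (IsHitChain ε z (List.ofFn x) ∧ (∀ q ∈ chainParams ω₀ ε z (List.ofFn x), 0 < q.1) ∧
        ((chainParams ω₀ ε z (List.ofFn x)).map Prod.fst).sum < t ∧
        Literature.Analysis.FunctionSpaces.virtualCentres ε z (chainParams ω₀ ε z (List.ofFn x)) = List.ofFn x) ∧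
      (∀ i, x i ∉ virtualTube ε z t (chainParams ω₀ ε z (List.ofFn x))) ∧
      (∀ a ∈ c, a ∉ virtualTube ε z t (chainParams ω₀ ε z (List.ofFn x))) := by
  unfold IsRealizable
  simp only [Literature.Analysis.FunctionSpaces.PointConfig.mem_union, Literature.Analysis.FunctionSpaces.PointConfig.mem_ofFn]
  constructor
  · rintro ⟨h1, h2, h3, h4, h5⟩
    exact ⟨⟨h1, h2, h3, h4⟩, fun i => h5 (x i) (Or.inr ⟨i, rfl⟩), fun a ha => h5 a (Or.inl ha)⟩
  · rintro ⟨⟨h1, h2, h3, h4⟩, h5, h6⟩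
    refine ⟨h1, h2, h3, h4, fun a ha => ?_⟩
    rcases ha with ha | ⟨i, rfl⟩
    · exact h6 a ha
    · exact h5 i

/-- The product of `n` copies of a scaled measure: `⨂ (a • μ) = aⁿ • ⨂ μ`. [folklore] -/
theorem pi_const_smul {α : Type*} [MeasurableSpace α] {n : ℕ} (μ : Fin n → Measure α)
    [∀ i, SigmaFinite (μ i)] {a : ℝ≥0∞} (ha : a ≠ ∞) :
    (Measure.pi fun i => a • μ i) = a ^ n • Measure.pi μ := by
  haveI : ∀ i, SigmaFinite (a • μ i) := fun i => by
    rw [← ENNReal.coe_toNNReal ha, Measure.coe_nnreal_smul]; infer_instance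
  refine Measure.pi_eq fun s _ => ?_
  simp only [Measure.smul_apply, smul_eq_mul, Measure.pi_pi, Finset.prod_mul_distrib,
    Finset.prod_const, Finset.card_univ, Fintype.card_fin]

/-- **Gallavotti's chain functional** `Q(l)` of an ordered list `l = [c₁, …, cₙ]` of candidate
scatterer centres (Golse 2012, proof of Thm. 2.1: the integrand after conditioning on the obstacles
met, "`f^in(…) e^{-n|T(t;c₁,…,c_j)|}`"; Spohn 1991, (8.133)): with `p = chainParams ω₀ ε z l` the path
coordinates of `l`,
`Q(l) = 1{l is a hit chain, durations of p positive with sum < t, virtualCentres ε z p = l,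
no cᵢ in the tube of p} · ofReal φ(virtualState z p t) · P{c : N_c(virtualTube ε z t p) = 0}` —
the deterministic conditions and self-avoidance of the chain, the observable at the end of the
virtual orbit, and the probability that the other scatterers avoid the tube.
[cite: Golse2011, Thm. 2.1 (proof: the integrand f^in e^{-n|T|})] -/
def chainFunctional {E : Type*} [NormedAddCommGroup E] [InnerProductSpace ℝ E] [MeasurableSpace E]
    (ω₀ : sphere (0 : E) 1) (ε : ℝ) (z : E × E) (t : ℝ) (φ : E × E → ℝ)
    (P : Measure (Literature.Analysis.FunctionSpaces.PointConfig E)) : List E → ℝ≥0∞ :=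
  {l : List E | (IsHitChain ε z l ∧ (∀ q ∈ chainParams ω₀ ε z l, 0 < q.1) ∧
      ((chainParams ω₀ ε z l).map Prod.fst).sum < t ∧
      Literature.Analysis.FunctionSpaces.virtualCentres ε z (chainParams ω₀ ε z l) = l) ∧
    ∀ a ∈ l, a ∉ virtualTube ε z t (chainParams ω₀ ε z l)}.indicator
    fun l => ENNReal.ofReal (φ (Literature.Analysis.FunctionSpaces.virtualState z (chainParams ω₀ ε z l) t)) *
      P {c | c.count (virtualTube ε z t (chainParams ω₀ ε z l)) = 0}

section ChainFunctional

variable {E : Type*} [NormedAddCommGroup E] [InnerProductSpace ℝ E] [MeasurableSpace E]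
  {ω₀ : sphere (0 : E) 1} {ε : ℝ} {z : E × E} {t : ℝ} {φ : E × E → ℝ} {P : Measure (Literature.Analysis.FunctionSpaces.PointConfig E)}

/-- The chain functional on a chain satisfying the deterministic conditions and self-avoidance.
[folklore] -/
theorem chainFunctional_of {l : List E}
    (h : (IsHitChain ε z l ∧ (∀ q ∈ chainParams ω₀ ε z l, 0 < q.1) ∧
      ((chainParams ω₀ ε z l).map Prod.fst).sum < t ∧
      Literature.Analysis.FunctionSpaces.virtualCentres ε z (chainParams ω₀ ε z l) = l) ∧
      ∀ a ∈ l, a ∉ virtualTube ε z t (chainParams ω₀ ε z l)) :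
    chainFunctional ω₀ ε z t φ P l = ENNReal.ofReal (φ (Literature.Analysis.FunctionSpaces.virtualState z (chainParams ω₀ ε z l) t)) *
      P {c | c.count (virtualTube ε z t (chainParams ω₀ ε z l)) = 0} := by
  classical
  simp only [chainFunctional, indicator_apply, mem_setOf_eq]
  rw [if_pos h]

/-- The chain functional vanishes off such chains. [folklore] -/
theorem chainFunctional_of_not {l : List E}
    (h : ¬ ((IsHitChain ε z l ∧ (∀ q ∈ chainParams ω₀ ε z l, 0 < q.1) ∧
      ((chainParams ω₀ ε z l).map Prod.fst).sum < t ∧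
      Literature.Analysis.FunctionSpaces.virtualCentres ε z (chainParams ω₀ ε z l) = l) ∧
      ∀ a ∈ l, a ∉ virtualTube ε z t (chainParams ω₀ ε z l))) :
    chainFunctional ω₀ ε z t φ P l = 0 := by
  classical
  simp only [chainFunctional, indicator_apply, mem_setOf_eq]
  rw [if_neg h]

/-- **The chain functional in path coordinates**: if `p` has positive durations summing to `< t`,
its realising centres `l = virtualCentres ε z p` form a hit chain with `chainParams ω₀ ε z l = p`
(round trip) and avoid the tube of `p`, then
`Q(l) = ofReal φ(virtualState z p t) · P{N(virtualTube ε z t p) = 0}`. [folklore] -/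
theorem chainFunctional_virtualCentres {p : List (ℝ × sphere (0 : E) 1)}
    (hhit : IsHitChain ε z (Literature.Analysis.FunctionSpaces.virtualCentres ε z p)) (hround : chainParams ω₀ ε z (Literature.Analysis.FunctionSpaces.virtualCentres ε z p) = p)
    (hdur : ∀ q ∈ p, 0 < q.1) (hsum : (p.map Prod.fst).sum < t)
    (hSA : ∀ a ∈ Literature.Analysis.FunctionSpaces.virtualCentres ε z p, a ∉ virtualTube ε z t p) :
    chainFunctional ω₀ ε z t φ P (Literature.Analysis.FunctionSpaces.virtualCentres ε z p) =
      ENNReal.ofReal (φ (Literature.Analysis.FunctionSpaces.virtualState z p t)) * P {c | c.count (virtualTube ε z t p) = 0} := by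
  have h : (IsHitChain ε z (Literature.Analysis.FunctionSpaces.virtualCentres ε z p) ∧
      (∀ q ∈ chainParams ω₀ ε z (Literature.Analysis.FunctionSpaces.virtualCentres ε z p), 0 < q.1) ∧
      ((chainParams ω₀ ε z (Literature.Analysis.FunctionSpaces.virtualCentres ε z p)).map Prod.fst).sum < t ∧
      Literature.Analysis.FunctionSpaces.virtualCentres ε z (chainParams ω₀ ε z (Literature.Analysis.FunctionSpaces.virtualCentres ε z p)) = Literature.Analysis.FunctionSpaces.virtualCentres ε z p) ∧
      ∀ a ∈ Literature.Analysis.FunctionSpaces.virtualCentres ε z p, a ∉ virtualTube ε z t (chainParams ω₀ ε z (Literature.Analysis.FunctionSpaces.virtualCentres ε z p)) := by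
    rw [hround]; exact ⟨⟨hhit, hdur, hsum, rfl⟩, hSA⟩
  rw [chainFunctional_of h, hround]

/-- The chain functional is bounded by the supremum of the observable times the void
probability, hence by the supremum (for a probability `P`). [folklore] -/
theorem chainFunctional_le [IsProbabilityMeasure P] {C : ℝ} (hC : ∀ w, φ w ≤ C) (l : List E) :
    chainFunctional ω₀ ε z t φ P l ≤ ENNReal.ofReal C := by
  unfold chainFunctional
  refine indicator_apply_le' (fun _ => ?_) (fun _ => bot_le)
  exact (mul_le_mul' (ENNReal.ofReal_le_ofReal (hC _)) prob_le_one).trans_eq (mul_one _)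

/-- The chain functional is supported on hit chains. [folklore] -/
theorem chainFunctional_eq_indicator_isHitChain :
    chainFunctional ω₀ ε z t φ P = {l | IsHitChain ε z l}.indicator (chainFunctional ω₀ ε z t φ P) := by
  funext l
  by_cases hl : l ∈ {l : List E | IsHitChain ε z l}
  · rw [indicator_of_mem hl]
  · rw [indicator_of_notMem hl, chainFunctional_of_not]
    exact fun h => hl h.1.1

/-- **Measurability of the chain functional on `n`-tuples** (`l = List.ofFn x`, `x ∈ Eⁿ`): the
deterministic set, the self-avoidance condition (sections of the measurable tube graph), the
observable at the end state and the void probability (`Kinetic.measurable_chainVoidProb`) are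
measurable. [folklore] -/
theorem measurable_chainFunctional_ofFn [FiniteDimensional ℝ E] [BorelSpace E]
    [SecondCountableTopology E] [SigmaCompactSpace E]
    (ω₀ : sphere (0 : E) 1) (ε : ℝ) (z : E × E) {t : ℝ} (ht : 0 ≤ t) {φ : E × E → ℝ}
    (hφ : Measurable φ) (P : Measure (Literature.Analysis.FunctionSpaces.PointConfig E)) [SFinite P] (n : ℕ) :
    Measurable fun x : Fin n → E => chainFunctional ω₀ ε z t φ P (List.ofFn x) := by
  classical
  have hdetm := measurableSet_chainDet (E := E) ω₀ ε z t n
  have htube := measurableSet_chainDet_tube (E := E) ω₀ ε z ht n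
  have hvoid := measurable_chainVoidProb (E := E) ω₀ ε z ht n P
  obtain ⟨F, hF, hFeq⟩ := exists_measurable_chainParams (E := E) ω₀ ε n
  have hFz : Measurable fun x : Fin n → E => F (z, x) :=
    hF.comp (measurable_const.prodMk measurable_id)
  have hval : Measurable fun x : Fin n → E =>
      ENNReal.ofReal (φ (Literature.Analysis.FunctionSpaces.virtualState z (chainParams ω₀ ε z (List.ofFn x)) t)) := by
    have h := (measurable_virtualState (E := E) n).comp
      ((measurable_const (a := z)).prodMk (hFz.prodMk (measurable_const (a := t))))
    have h' : Measurable fun x : Fin n → E =>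
        ENNReal.ofReal (φ (Literature.Analysis.FunctionSpaces.virtualState z (List.ofFn (F (z, x))) t)) :=
      ENNReal.measurable_ofReal.comp (hφ.comp h)
    convert h' using 3 with x
    rw [hFeq (z, x)]
  -- the deterministic set `D` and its pull-back `S = ofFn ⁻¹' D`
  set D : Set (List E) := {l | IsHitChain ε z l ∧
    (∀ q ∈ chainParams ω₀ ε z l, 0 < q.1) ∧ ((chainParams ω₀ ε z l).map Prod.fst).sum < t ∧
    Literature.Analysis.FunctionSpaces.virtualCentres ε z (chainParams ω₀ ε z l) = l} with hD
  set S : Set (Fin n → E) := {x : Fin n → E |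
    IsHitChain ε z (List.ofFn x) ∧ (∀ q ∈ chainParams ω₀ ε z (List.ofFn x), 0 < q.1) ∧
    ((chainParams ω₀ ε z (List.ofFn x)).map Prod.fst).sum < t ∧
    Literature.Analysis.FunctionSpaces.virtualCentres ε z (chainParams ω₀ ε z (List.ofFn x)) = List.ofFn x} with hS
  have hSD : ∀ x, x ∈ S ↔ List.ofFn x ∈ D := fun x => Iff.rfl
  -- the set `{x | ofFn x ∈ D ∧ SA}`
  have hSA : MeasurableSet {x : Fin n → E | List.ofFn x ∈ D ∧
      ∀ i, x i ∉ virtualTube ε z t (chainParams ω₀ ε z (List.ofFn x))} := by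
    have heq : {x : Fin n → E | List.ofFn x ∈ D ∧
        ∀ i, x i ∉ virtualTube ε z t (chainParams ω₀ ε z (List.ofFn x))} =
        {x | List.ofFn x ∈ D} ∩ ⋂ i, ((fun x => (x, x i)) ⁻¹'
          {p : (Fin n → E) × E | (List.ofFn p.1 ∈ D) ∧
            p.2 ∈ virtualTube ε z t (chainParams ω₀ ε z (List.ofFn p.1))})ᶜ := by
      ext x
      simp only [mem_setOf_eq, mem_inter_iff, mem_iInter, mem_compl_iff, mem_preimage, not_and]
      constructor
      · rintro ⟨h1, h2⟩; exact ⟨h1, fun i _ => h2 i⟩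
      · rintro ⟨h1, h2⟩; exact ⟨h1, fun i => h2 i h1⟩
    rw [heq]
    refine hdetm.inter (MeasurableSet.iInter fun i => (htube.preimage
      (measurable_id.prodMk (measurable_pi_apply i))).compl)
  have hprod : Measurable fun x : Fin n → E =>
      ENNReal.ofReal (φ (Literature.Analysis.FunctionSpaces.virtualState z (chainParams ω₀ ε z (List.ofFn x)) t)) *
        S.indicator (fun x => P {c | c.count (virtualTube ε z t
          (chainParams ω₀ ε z (List.ofFn x))) = 0}) x := hval.mul hvoid
  have heqQ : (fun x : Fin n → E => chainFunctional ω₀ ε z t φ P (List.ofFn x)) =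
      {x : Fin n → E | List.ofFn x ∈ D ∧
        ∀ i, x i ∉ virtualTube ε z t (chainParams ω₀ ε z (List.ofFn x))}.indicator
        (fun x => ENNReal.ofReal (φ (Literature.Analysis.FunctionSpaces.virtualState z (chainParams ω₀ ε z (List.ofFn x)) t)) *
          S.indicator (fun x => P {c | c.count (virtualTube ε z t
            (chainParams ω₀ ε z (List.ofFn x))) = 0}) x) := by
    funext x
    simp only [chainFunctional, indicator_apply, mem_setOf_eq]
    by_cases hx : List.ofFn x ∈ D ∧ ∀ i, x i ∉ virtualTube ε z t (chainParams ω₀ ε z (List.ofFn x))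
    · have hmem : (IsHitChain ε z (List.ofFn x) ∧ (∀ q ∈ chainParams ω₀ ε z (List.ofFn x), 0 < q.1) ∧
          ((chainParams ω₀ ε z (List.ofFn x)).map Prod.fst).sum < t ∧
          Literature.Analysis.FunctionSpaces.virtualCentres ε z (chainParams ω₀ ε z (List.ofFn x)) = List.ofFn x) ∧
          ∀ a ∈ List.ofFn x, a ∉ virtualTube ε z t (chainParams ω₀ ε z (List.ofFn x)) :=
        ⟨(hSD x).2 hx.1, (List.forall_mem_ofFn_iff).2 hx.2⟩
      rw [if_pos hmem, if_pos hx, if_pos ((hSD x).2 hx.1)]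
    · have hnmem : ¬ ((IsHitChain ε z (List.ofFn x) ∧
          (∀ q ∈ chainParams ω₀ ε z (List.ofFn x), 0 < q.1) ∧
          ((chainParams ω₀ ε z (List.ofFn x)).map Prod.fst).sum < t ∧
          Literature.Analysis.FunctionSpaces.virtualCentres ε z (chainParams ω₀ ε z (List.ofFn x)) = List.ofFn x) ∧
          ∀ a ∈ List.ofFn x, a ∉ virtualTube ε z t (chainParams ω₀ ε z (List.ofFn x))) :=
        fun h => hx ⟨(hSD x).1 h.1, fun i => h.2 (x i) (List.mem_ofFn.2 ⟨i, rfl⟩)⟩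
      rw [if_neg hnmem, if_neg hx]
  rw [heqQ]
  exact hprod.indicator hSA

/-- **Measurability of the chain functional in path coordinates**: `q ↦ Q(virtualCentres ε z q)`
is measurable on `(ℝ × S^{d-1})ⁿ` (composition with the measurable realising-centres map,
`Kinetic.exists_measurable_virtualCentres`). [folklore] -/
theorem measurable_chainFunctional_virtualCentres [FiniteDimensional ℝ E] [BorelSpace E]
    [SecondCountableTopology E] [SigmaCompactSpace E]
    (ω₀ : sphere (0 : E) 1) (ε : ℝ) (z : E × E) {t : ℝ} (ht : 0 ≤ t) {φ : E × E → ℝ}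
    (hφ : Measurable φ) (P : Measure (Literature.Analysis.FunctionSpaces.PointConfig E)) [SFinite P] (n : ℕ) :
    Measurable fun q : Fin n → ℝ × sphere (0 : E) 1 =>
      chainFunctional ω₀ ε z t φ P (Literature.Analysis.FunctionSpaces.virtualCentres ε z (List.ofFn q)) := by
  obtain ⟨G, hG, hGeq⟩ := exists_measurable_virtualCentres (E := E) ε n
  have heq : (fun q : Fin n → ℝ × sphere (0 : E) 1 =>
      chainFunctional ω₀ ε z t φ P (Literature.Analysis.FunctionSpaces.virtualCentres ε z (List.ofFn q))) =
      (fun x : Fin n → E => chainFunctional ω₀ ε z t φ P (List.ofFn x)) ∘ fun q => G (z, q) := by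
    funext q; simp only [Function.comp_apply]; rw [hGeq (z, q)]
  rw [heq]
  exact (measurable_chainFunctional_ofFn ω₀ ε z ht hφ P n).comp
    (hG.comp ((measurable_const (a := z)).prodMk measurable_id))

end ChainFunctional

/-- **The `n`-scatterer term as a path integral.** Let the multivariate Mecke equation and the
hard-sphere entrance parametrisation (named facts) hold, let `P` be the Poisson law of intensity
`σ ε^{1-d}` Lebesgue, `ε, σ > 0`, `z = (x, v)` with `v ≠ 0`, `t ≥ 0`, `φ` measurable. Then the
expected sum over ordered `n`-tuples of distinct scatterers of the `n`-scatterer functional is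
`(ofReal σ)ⁿ · pathLIntegral z n (Q ∘ virtualCentres ε z)` with `Q` Gallavotti's chain functional
(Golse 2012, proof of Thm. 2.1; Spohn 1991, (8.133)).
[cite: Golse2011, Thm. 2.1 (proof: e^{-n|T|} and the change of variables)] -/
theorem lintegral_tsum_scattererFunctional_eq_pathLIntegral
    (hM : Literature.Analysis.FunctionSpaces.IsPoissonPointProcess.multivariateMecke.{u})
    (hP4 : hardSphere_entranceParametrization.{u}) {σ ε : ℝ} (hσ : 0 < σ) (hε : 0 < ε)
    {P : Measure (Literature.Analysis.FunctionSpaces.PointConfig (EuclideanSpace ℝ d))}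
    (hP : Literature.Analysis.FunctionSpaces.IsPoissonPointProcess (ENNReal.ofReal (σ * (ε ^ (Fintype.card d - 1))⁻¹) •
      (volume : Measure (EuclideanSpace ℝ d))) P)
    (ω₀ : sphere (0 : EuclideanSpace ℝ d) 1) (z : EuclideanSpace ℝ d × EuclideanSpace ℝ d)
    (hv : z.2 ≠ 0) {t : ℝ} (ht : 0 ≤ t) {φ : EuclideanSpace ℝ d × EuclideanSpace ℝ d → ℝ}
    (hφ : Measurable φ) (n : ℕ) :
    ∫⁻ c, ∑' x : {x : Fin n → EuclideanSpace ℝ d // Function.Injective x ∧ ∀ i, x i ∈ c},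
        scattererFunctional ω₀ ε z t φ (List.ofFn x.1) c ∂P =
      ENNReal.ofReal σ ^ n * pathLIntegral z n (fun p =>
        chainFunctional ω₀ ε z t φ P (Literature.Analysis.FunctionSpaces.virtualCentres ε z p)) := by
  classical
  haveI := hP.isProbabilityMeasure
  set lam : ℝ≥0∞ := ENNReal.ofReal (σ * (ε ^ (Fintype.card d - 1))⁻¹) with hlam
  haveI hsf : SigmaFinite (lam • (volume : Measure (EuclideanSpace ℝ d))) := by
    have : lam • (volume : Measure (EuclideanSpace ℝ d)) =
        (σ * (ε ^ (Fintype.card d - 1))⁻¹).toNNReal • (volume : Measure (EuclideanSpace ℝ d)) := by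
      rw [hlam, ENNReal.ofReal, ENNReal.smul_def]
    rw [this]; infer_instance
  set Q : List (EuclideanSpace ℝ d) → ℝ≥0∞ := chainFunctional ω₀ ε z t φ P with hQ
  -- Step 1: Mecke
  have hmeas := measurable_scattererFunctional (E := EuclideanSpace ℝ d) ω₀ ε z ht hφ n
  have hMecke := hM hP n (fun p => scattererFunctional ω₀ ε z t φ (List.ofFn p.1) p.2) hmeas
  simp only at hMecke
  rw [hMecke]
  -- Step 2: the inner integral is `Q (ofFn x)` (void probability factors out)
  have hinner : ∀ x : Fin n → EuclideanSpace ℝ d,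
      ∫⁻ c, scattererFunctional ω₀ ε z t φ (List.ofFn x) (c ∪ Literature.Analysis.FunctionSpaces.PointConfig.ofFn x) ∂P = Q (List.ofFn x) := by
    intro x
    by_cases hdet : (IsHitChain ε z (List.ofFn x) ∧ (∀ q ∈ chainParams ω₀ ε z (List.ofFn x), 0 < q.1) ∧
        ((chainParams ω₀ ε z (List.ofFn x)).map Prod.fst).sum < t ∧
        Literature.Analysis.FunctionSpaces.virtualCentres ε z (chainParams ω₀ ε z (List.ofFn x)) = List.ofFn x) ∧
        ∀ i, x i ∉ virtualTube ε z t (chainParams ω₀ ε z (List.ofFn x))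
    · rw [hQ, chainFunctional_of ⟨hdet.1, (List.forall_mem_ofFn_iff).2 hdet.2⟩]
      have hfun : (fun c => scattererFunctional ω₀ ε z t φ (List.ofFn x) (c ∪ Literature.Analysis.FunctionSpaces.PointConfig.ofFn x)) =
          {c : Literature.Analysis.FunctionSpaces.PointConfig (EuclideanSpace ℝ d) | c.count (virtualTube ε z t
            (chainParams ω₀ ε z (List.ofFn x))) = 0}.indicator
            (fun _ => ENNReal.ofReal (φ (Literature.Analysis.FunctionSpaces.virtualState z (chainParams ω₀ ε z (List.ofFn x)) t))) := by
        funext c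
        by_cases hc : ∀ a ∈ c, a ∉ virtualTube ε z t (chainParams ω₀ ε z (List.ofFn x))
        · have hR : IsRealizable ω₀ ε z t (List.ofFn x) (c ∪ Literature.Analysis.FunctionSpaces.PointConfig.ofFn x) :=
            (isRealizable_union_ofFn_iff ω₀ ε z t x c).2 ⟨hdet.1, hdet.2, hc⟩
          rw [scattererFunctional_of hR, indicator_of_mem]
          exact (forall_notMem_iff_count_eq_zero c _).1 hc
        · have hR : ¬ IsRealizable ω₀ ε z t (List.ofFn x) (c ∪ Literature.Analysis.FunctionSpaces.PointConfig.ofFn x) := fun h =>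
            hc ((isRealizable_union_ofFn_iff ω₀ ε z t x c).1 h).2.2
          rw [scattererFunctional_of_not hR, indicator_of_notMem]
          exact fun h => hc ((forall_notMem_iff_count_eq_zero c _).2 h)
      rw [hfun, lintegral_indicator_const]
      exact (Literature.Analysis.FunctionSpaces.PointConfig.measurable_count (measurableSet_virtualTube ε z t _))
        (measurableSet_singleton 0)
    · rw [hQ, chainFunctional_of_not (fun h => hdet ⟨h.1, fun i => h.2 (x i) (List.mem_ofFn.2 ⟨i, rfl⟩)⟩)]
      have hfun : (fun c => scattererFunctional ω₀ ε z t φ (List.ofFn x) (c ∪ Literature.Analysis.FunctionSpaces.PointConfig.ofFn x)) =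
          fun _ => 0 := by
        funext c
        exact scattererFunctional_of_not fun hR =>
          hdet (let h := (isRealizable_union_ofFn_iff ω₀ ε z t x c).1 hR; ⟨h.1, h.2.1⟩)
      rw [hfun, lintegral_zero]
  simp_rw [hinner]
  -- Step 3: `(λ Leb)ⁿ = λⁿ Lebⁿ` and the iterated integral
  have hQm : Measurable fun x : Fin n → EuclideanSpace ℝ d => Q (List.ofFn x) :=
    measurable_chainFunctional_ofFn ω₀ ε z ht hφ P n
  rw [pi_const_smul (fun _ : Fin n => (volume : Measure (EuclideanSpace ℝ d))) ENNReal.ofReal_ne_top,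
    lintegral_smul_measure,
    lintegral_pi_ofFn volume n Q hQm]
  -- Step 4: `Q` is supported on hit chains; the `n`-fold entrance parametrisation
  have hQhit : Q = {l | IsHitChain ε z l}.indicator Q := chainFunctional_eq_indicator_isHitChain
  rw [hQhit, iterLIntegral_hitChain_eq_pathLIntegral hP4 hε n z hv Q (by rwa [← hQhit]), ← hQhit,
    smul_eq_mul, ← mul_assoc]
  -- Step 5: constants `λⁿ ε^{n(d-1)} = σⁿ`
  have hconst : lam ^ n * ENNReal.ofReal (ε ^ (Fintype.card d - 1)) ^ n = ENNReal.ofReal σ ^ n := by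
    rw [← mul_pow, hlam, ← ENNReal.ofReal_mul (by positivity)]
    congr 2
    have hεpow : (ε ^ (Fintype.card d - 1)) ≠ 0 := pow_ne_zero _ hε.ne'
    field_simp
  rw [hconst]

end

end Literature.MathematicalPhysics.KineticTheory
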